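import Summits.CriticalPhenomena.PercolationContinuityZ3.Theorems.Transplant.FKConnectivityAllQPat3KNetSPSteps
import Summits.CriticalPhenomena.PercolationContinuityZ3.Theorems.Transplant.FKConnectivityAllQPat3KNetViewsPar
import Summits.CriticalPhenomena.PercolationContinuityZ3.Theorems.Transplant.FKConnectivityAllQPat3MinorRecursion
import HarnessLib

/-!
# Connectivity correlation inequalities for `φ_{w,q}`, every `q > 0` — THEOREM SP(𝒦), one marked POLE (`pb`), the BRIDGE side

Helper file (`--supports stmt-CriticalPhenomena-4575`), census lineage (gen 41) of LANE 2's FK sub-programme; builds on p205010 (kernel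
theorem, internal audit signed; external expert review pending).  No definitions, no named facts, no sorries; standard axioms.

The `pb` step of THEOREM SP(𝒦)'s inner recursion (census g41 memo §6 (c), drafts/README): `N = E₁ ∥ E₂` between `x, y`, the marks are
the pole `x` and two inner vertices `s, t` of `E₁ = BRIDGE(Qac, Qad, Qbc, Qbd, Qcd; x, y)`.  As in «Pat3KNetSPBridgeI» every position of
`s, t` is ONE VIEW («Pat3KNetViewsPar») away from: the type-I statement (hypothesis `hTypeI` — the finished `FK.typeIK_good`), the `pb`
induction hypothesis `ih` (sides of size `≤ n`), a CORNER («Pat3KNetSPSteps») or THEOREM 𝒯₂(𝒦) — except the two VEE* leaves with the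
vertex mark `x` and two marked slots inside the triangle `y c d` (hypotheses `hVeeY`: slots `yc, yd`; `hVeeC`: slots `yc, cd`).
* `FK.pbK_bridge_corner_any` — a corner `c` is marked: view at `ac`, both poles marked ⇒ 𝒯₂(𝒦);
* `FK.pbK_bridge_x_corner` — a mark interior to `Qac`, the other off `Qac` ⇒ CORNER at `x` in the view at `ac`;
* `FK.pbK_bridge_slot_ac / _slot_cd / _slot_bc` — both marks in one slot ⇒ `ih` / `hTypeI` at the view;
* `FK.pbK_bridge_dispatch` — the whole `| bridge` alternative of `FK.pbK_good`, modulo `hVeeY`, `hVeeC`.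
[cite: AyyerLinussonRavichandran2025, §7 (p. 22)]
-/

namespace Summit.CriticalPhenomena.PercolationContinuityZ3.Theorems

namespace FK

open SimpleGraph Literature.Probability.LatticeModels Literature.Probability.Percolation
open scoped Classical

variable {V : Type*}

section PbBridge

variable [Fintype V] {n : ℕ} {N₀ : Finset (Sym2 V)} {Qac Qad Qbc Qbd Qcd E₂ E C : Finset (Sym2 V)} {x y c d s t : V}

/-- **`pb`, bridge side, the corner `c` marked**: in the view at `ac` both poles `x, c` are marked and the third mark is inner — THEOREM
𝒯₂(𝒦) (`FK.spGoodC_inner_of_isKNet`). [cite: AyyerLinussonRavichandran2025, §7 (p. 22)] -/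
theorem pbK_bridge_corner_any
    (hac : IsKNet Qac x c) (had : IsKNet Qad x d) (hbc : IsKNet Qbc y c) (hbd : IsKNet Qbd y d) (hcd : IsKNet Qcd c d)
    (hsep : BridgeSep Qac Qad Qbc Qbd Qcd x y c d) (h₂ : IsKNet E₂ x y) (hd : Disjoint (Qac ∪ Qad ∪ Qbc ∪ Qbd ∪ Qcd) E₂)
    (hV : ∀ z : V, (∃ e ∈ Qac ∪ Qad ∪ Qbc ∪ Qbd ∪ Qcd, z ∈ e) → (∃ e ∈ E₂, z ∈ e) → z = x ∨ z = y)
    (hE : E ⊆ Qac ∪ Qad ∪ Qbc ∪ Qbd ∪ Qcd ∪ E₂) (hC : C ⊆ Qac ∪ Qad ∪ Qbc ∪ Qbd ∪ Qcd ∪ E₂)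
    (ht : ∃ e ∈ Qac ∪ Qad ∪ Qbc ∪ Qbd ∪ Qcd ∪ E₂, t ∈ e) (htx : t ≠ x) (htc : t ≠ c) : SPGoodC E C x c t := by
  obtain ⟨eN, hB, hdQ, hVQ⟩ := bridgePar_view_ac hac had hbc hbd hcd hsep h₂ hd hV
  rw [eN] at hE hC ht
  exact spGoodC_inner_of_isKNet (IsKNet.parallel hac hB hdQ hVQ) hE hC ht htx htc

/-- **`pb`, bridge side, CORNER at the pole**: one mark interior to `Qac`, the other mark off `Qac`: in the view at `ac` this is a CORNER
with the corner `x`. [cite: AyyerLinussonRavichandran2025, §7 (p. 22)] -/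
theorem pbK_bridge_x_corner
    (hac : IsKNet Qac x c) (had : IsKNet Qad x d) (hbc : IsKNet Qbc y c) (hbd : IsKNet Qbd y d) (hcd : IsKNet Qcd c d)
    (hsep : BridgeSep Qac Qad Qbc Qbd Qcd x y c d) (h₂ : IsKNet E₂ x y) (hd : Disjoint (Qac ∪ Qad ∪ Qbc ∪ Qbd ∪ Qcd) E₂)
    (hV : ∀ z : V, (∃ e ∈ Qac ∪ Qad ∪ Qbc ∪ Qbd ∪ Qcd, z ∈ e) → (∃ e ∈ E₂, z ∈ e) → z = x ∨ z = y)
    (hE : E ⊆ Qac ∪ Qad ∪ Qbc ∪ Qbd ∪ Qcd ∪ E₂) (hC : C ⊆ Qac ∪ Qad ∪ Qbc ∪ Qbd ∪ Qcd ∪ E₂)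
    (hs : ∃ e ∈ Qac, s ∈ e) (hsx : s ≠ x) (hsc : s ≠ c)
    (ht : ∃ e ∈ E₂ ∪ Qad ∪ Qbc ∪ Qcd ∪ Qbd, t ∈ e) (htx : t ≠ x) (htc : t ≠ c) : SPGoodC E C x s t := by
  obtain ⟨eN, hB, hdQ, hVQ⟩ := bridgePar_view_ac hac had hbc hbd hcd hsep h₂ hd hV
  rw [eN] at hE hC
  have hc := spGoodC_cornerK hdQ hVQ hac hB (Finset.inter_subset_right (s₁ := E)) (Finset.inter_subset_right (s₁ := C))
    (Finset.inter_subset_right (s₁ := E)) (Finset.inter_subset_right (s₁ := C)) hs ht hsx hsc htx htc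
  exact hc.congr_sets (inter_union2_eq hE rfl) (inter_union2_eq hC rfl)

omit [Fintype V] in
/-- **`pb`, bridge side, both inner marks interior to `Qac`**: the view at `ac` keeps the pole `x` as a pole — the `pb` induction
hypothesis on the smaller side `Qac`. [cite: AyyerLinussonRavichandran2025, §7 (p. 22)] -/
theorem pbK_bridge_slot_ac
    (ih : ∀ {E₁ E₂ E C : Finset (Sym2 V)} {x y s t : V}, E₁.card ≤ n →
      IsKNet E₁ x y → IsKNet E₂ x y → Disjoint E₁ E₂ → E₁ ∪ E₂ ⊆ N₀ →
      (∀ z : V, (∃ e ∈ E₁, z ∈ e) → (∃ e ∈ E₂, z ∈ e) → z = x ∨ z = y) →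
      E ⊆ E₁ ∪ E₂ → C ⊆ E₁ ∪ E₂ →
      (∃ e ∈ E₁, s ∈ e) → (∃ e ∈ E₁, t ∈ e) →
      s ≠ x → s ≠ y → t ≠ x → t ≠ y → s ≠ t → SPGoodC E C x s t)
    (hac : IsKNet Qac x c) (had : IsKNet Qad x d) (hbc : IsKNet Qbc y c) (hbd : IsKNet Qbd y d) (hcd : IsKNet Qcd c d)
    (hsep : BridgeSep Qac Qad Qbc Qbd Qcd x y c d) (h₂ : IsKNet E₂ x y) (hd : Disjoint (Qac ∪ Qad ∪ Qbc ∪ Qbd ∪ Qcd) E₂) (hN : Qac ∪ Qad ∪ Qbc ∪ Qbd ∪ Qcd ∪ E₂ ⊆ N₀)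
    (hV : ∀ z : V, (∃ e ∈ Qac ∪ Qad ∪ Qbc ∪ Qbd ∪ Qcd, z ∈ e) → (∃ e ∈ E₂, z ∈ e) → z = x ∨ z = y)
    (hE : E ⊆ Qac ∪ Qad ∪ Qbc ∪ Qbd ∪ Qcd ∪ E₂) (hC : C ⊆ Qac ∪ Qad ∪ Qbc ∪ Qbd ∪ Qcd ∪ E₂) (hcard : (Qac ∪ Qad ∪ Qbc ∪ Qbd ∪ Qcd).card ≤ n + 1)
    (hs : ∃ e ∈ Qac, s ∈ e) (ht : ∃ e ∈ Qac, t ∈ e) (hsx : s ≠ x) (hsc : s ≠ c) (htx : t ≠ x) (htc : t ≠ c) (hst : s ≠ t) :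
    SPGoodC E C x s t := by
  obtain ⟨eN, hB, hdQ, hVQ⟩ := bridgePar_view_ac hac had hbc hbd hcd hsep h₂ hd hV
  have hlt := card_ac_lt_bridge hcd hsep
  rw [eN] at hE hC hN
  exact ih (by omega) hac hB hdQ hN hVQ hE hC hs ht hsx hsc htx htc hst

omit [Fintype V] in
/-- **`pb`, bridge side, both inner marks interior to `Qcd`**: in the view at `cd` the pole `x` is an inner vertex of the completed
bridge — the type-I statement. [cite: AyyerLinussonRavichandran2025, §7 (p. 22)] -/
theorem pbK_bridge_slot_cd
    (hTypeI : ∀ {E₁ E₂ E C : Finset (Sym2 V)} {x y b s t : V},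
      IsKNet E₁ x y → IsKNet E₂ x y → Disjoint E₁ E₂ → E₁ ∪ E₂ ⊆ N₀ →
      (∀ z : V, (∃ e ∈ E₁, z ∈ e) → (∃ e ∈ E₂, z ∈ e) → z = x ∨ z = y) →
      E ⊆ E₁ ∪ E₂ → C ⊆ E₁ ∪ E₂ →
      (∃ e ∈ E₁, s ∈ e) → (∃ e ∈ E₁, t ∈ e) → (∃ e ∈ E₂, b ∈ e) →
      s ≠ x → s ≠ y → t ≠ x → t ≠ y → b ≠ x → b ≠ y → s ≠ t → SPGoodC E C b s t)
    (hac : IsKNet Qac x c) (had : IsKNet Qad x d) (hbc : IsKNet Qbc y c) (hbd : IsKNet Qbd y d) (hcd : IsKNet Qcd c d)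
    (hsep : BridgeSep Qac Qad Qbc Qbd Qcd x y c d) (h₂ : IsKNet E₂ x y) (hd : Disjoint (Qac ∪ Qad ∪ Qbc ∪ Qbd ∪ Qcd) E₂) (hN : Qac ∪ Qad ∪ Qbc ∪ Qbd ∪ Qcd ∪ E₂ ⊆ N₀)
    (hV : ∀ z : V, (∃ e ∈ Qac ∪ Qad ∪ Qbc ∪ Qbd ∪ Qcd, z ∈ e) → (∃ e ∈ E₂, z ∈ e) → z = x ∨ z = y)
    (hE : E ⊆ Qac ∪ Qad ∪ Qbc ∪ Qbd ∪ Qcd ∪ E₂) (hC : C ⊆ Qac ∪ Qad ∪ Qbc ∪ Qbd ∪ Qcd ∪ E₂)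
    (hs : ∃ e ∈ Qcd, s ∈ e) (ht : ∃ e ∈ Qcd, t ∈ e) (hsc : s ≠ c) (hsd : s ≠ d) (htc : t ≠ c) (htd : t ≠ d) (hst : s ≠ t) :
    SPGoodC E C x s t := by
  obtain ⟨eN, hB, hdQ, hVQ⟩ := bridgePar_view_cd hac had hbc hbd hsep h₂ hd hV
  rw [eN] at hE hC hN
  obtain ⟨f, hf, hxf⟩ := hac.left_mem
  exact hTypeI hcd hB hdQ hN hVQ hE hC hs ht ⟨f, Finset.mem_union_left _ (Finset.mem_union_left _ (Finset.mem_union_left _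
    (Finset.mem_union_left _ hf))), hxf⟩ hsc hsd htc htd hac.ne had.ne hst

omit [Fintype V] in
/-- **`pb`, bridge side, both inner marks interior to `Qbc`**: the view at `bc` (poles `y, c`), the pole `x` inner in the completed
bridge — the type-I statement. [cite: AyyerLinussonRavichandran2025, §7 (p. 22)] -/
theorem pbK_bridge_slot_bc
    (hTypeI : ∀ {E₁ E₂ E C : Finset (Sym2 V)} {x y b s t : V},
      IsKNet E₁ x y → IsKNet E₂ x y → Disjoint E₁ E₂ → E₁ ∪ E₂ ⊆ N₀ →
      (∀ z : V, (∃ e ∈ E₁, z ∈ e) → (∃ e ∈ E₂, z ∈ e) → z = x ∨ z = y) →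
      E ⊆ E₁ ∪ E₂ → C ⊆ E₁ ∪ E₂ →
      (∃ e ∈ E₁, s ∈ e) → (∃ e ∈ E₁, t ∈ e) → (∃ e ∈ E₂, b ∈ e) →
      s ≠ x → s ≠ y → t ≠ x → t ≠ y → b ≠ x → b ≠ y → s ≠ t → SPGoodC E C b s t)
    (hac : IsKNet Qac x c) (had : IsKNet Qad x d) (hbc : IsKNet Qbc y c) (hbd : IsKNet Qbd y d) (hcd : IsKNet Qcd c d)
    (hsep : BridgeSep Qac Qad Qbc Qbd Qcd x y c d) (h₂ : IsKNet E₂ x y) (hd : Disjoint (Qac ∪ Qad ∪ Qbc ∪ Qbd ∪ Qcd) E₂) (hN : Qac ∪ Qad ∪ Qbc ∪ Qbd ∪ Qcd ∪ E₂ ⊆ N₀)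
    (hV : ∀ z : V, (∃ e ∈ Qac ∪ Qad ∪ Qbc ∪ Qbd ∪ Qcd, z ∈ e) → (∃ e ∈ E₂, z ∈ e) → z = x ∨ z = y)
    (hE : E ⊆ Qac ∪ Qad ∪ Qbc ∪ Qbd ∪ Qcd ∪ E₂) (hC : C ⊆ Qac ∪ Qad ∪ Qbc ∪ Qbd ∪ Qcd ∪ E₂)
    (hs : ∃ e ∈ Qbc, s ∈ e) (ht : ∃ e ∈ Qbc, t ∈ e) (hsy : s ≠ y) (hsc : s ≠ c) (hty : t ≠ y) (htc : t ≠ c) (hst : s ≠ t) :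
    SPGoodC E C x s t := by
  have eN₀ : Qac ∪ Qad ∪ Qbc ∪ Qbd ∪ Qcd = Qbc ∪ Qbd ∪ Qac ∪ Qad ∪ Qcd := by ac_rfl
  rw [eN₀] at hd hN hV hE hC
  obtain ⟨eN, hB, hdQ, hVQ⟩ := bridgePar_view_ac hbc hbd hac had hcd hsep.symm h₂.symm hd (fun z h1 h2 => (hV z h1 h2).symm)
  rw [eN] at hE hC hN
  obtain ⟨f, hf, hxf⟩ := hac.left_mem
  have hxy : x ≠ y := fun h => hbc.ne (hsep.v_ac_bc y (h ▸ hac.left_mem) hbc.left_mem)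
  exact hTypeI hbc hB hdQ hN hVQ hE hC hs ht ⟨f, Finset.mem_union_left _ (Finset.mem_union_left _ (Finset.mem_union_right _ hf)), hxf⟩
    hsy hsc hty htc hxy hac.ne hst

/-- **THE `pb` BRIDGE BRANCH, modulo the two VEE* leaves**: the `| bridge` alternative of `FK.pbK_good` (census g41 drafts).
[cite: AyyerLinussonRavichandran2025, §7 (p. 22)] -/
theorem pbK_bridge_dispatch
    (hTypeI : ∀ {E₁ E₂ E C : Finset (Sym2 V)} {x y b s t : V},
      IsKNet E₁ x y → IsKNet E₂ x y → Disjoint E₁ E₂ → E₁ ∪ E₂ ⊆ N₀ →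
      (∀ z : V, (∃ e ∈ E₁, z ∈ e) → (∃ e ∈ E₂, z ∈ e) → z = x ∨ z = y) →
      E ⊆ E₁ ∪ E₂ → C ⊆ E₁ ∪ E₂ →
      (∃ e ∈ E₁, s ∈ e) → (∃ e ∈ E₁, t ∈ e) → (∃ e ∈ E₂, b ∈ e) →
      s ≠ x → s ≠ y → t ≠ x → t ≠ y → b ≠ x → b ≠ y → s ≠ t → SPGoodC E C b s t)
    (ih : ∀ {E₁ E₂ E C : Finset (Sym2 V)} {x y s t : V}, E₁.card ≤ n →
      IsKNet E₁ x y → IsKNet E₂ x y → Disjoint E₁ E₂ → E₁ ∪ E₂ ⊆ N₀ →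
      (∀ z : V, (∃ e ∈ E₁, z ∈ e) → (∃ e ∈ E₂, z ∈ e) → z = x ∨ z = y) →
      E ⊆ E₁ ∪ E₂ → C ⊆ E₁ ∪ E₂ →
      (∃ e ∈ E₁, s ∈ e) → (∃ e ∈ E₁, t ∈ e) →
      s ≠ x → s ≠ y → t ≠ x → t ≠ y → s ≠ t → SPGoodC E C x s t)
    (hVeeY : ∀ {Qac Qad Qbc Qbd Qcd E₂ E C : Finset (Sym2 V)} {x y c d s t : V},
      IsKNet Qac x c → IsKNet Qad x d → IsKNet Qbc y c → IsKNet Qbd y d → IsKNet Qcd c d → BridgeSep Qac Qad Qbc Qbd Qcd x y c d →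
      IsKNet E₂ x y → Disjoint (Qac ∪ Qad ∪ Qbc ∪ Qbd ∪ Qcd) E₂ → Qac ∪ Qad ∪ Qbc ∪ Qbd ∪ Qcd ∪ E₂ ⊆ N₀ →
      (∀ z : V, (∃ e ∈ Qac ∪ Qad ∪ Qbc ∪ Qbd ∪ Qcd, z ∈ e) → (∃ e ∈ E₂, z ∈ e) → z = x ∨ z = y) →
      E ⊆ Qac ∪ Qad ∪ Qbc ∪ Qbd ∪ Qcd ∪ E₂ → C ⊆ Qac ∪ Qad ∪ Qbc ∪ Qbd ∪ Qcd ∪ E₂ →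
      (∃ e ∈ Qbc, s ∈ e) → s ≠ y → s ≠ c → (∃ e ∈ Qbd, t ∈ e) → t ≠ y → t ≠ d → SPGoodC E C x s t)
    (hVeeC : ∀ {Qac Qad Qbc Qbd Qcd E₂ E C : Finset (Sym2 V)} {x y c d s t : V},
      IsKNet Qac x c → IsKNet Qad x d → IsKNet Qbc y c → IsKNet Qbd y d → IsKNet Qcd c d → BridgeSep Qac Qad Qbc Qbd Qcd x y c d →
      IsKNet E₂ x y → Disjoint (Qac ∪ Qad ∪ Qbc ∪ Qbd ∪ Qcd) E₂ → Qac ∪ Qad ∪ Qbc ∪ Qbd ∪ Qcd ∪ E₂ ⊆ N₀ →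
      (∀ z : V, (∃ e ∈ Qac ∪ Qad ∪ Qbc ∪ Qbd ∪ Qcd, z ∈ e) → (∃ e ∈ E₂, z ∈ e) → z = x ∨ z = y) →
      E ⊆ Qac ∪ Qad ∪ Qbc ∪ Qbd ∪ Qcd ∪ E₂ → C ⊆ Qac ∪ Qad ∪ Qbc ∪ Qbd ∪ Qcd ∪ E₂ →
      (∃ e ∈ Qbc, s ∈ e) → s ≠ y → s ≠ c → (∃ e ∈ Qcd, t ∈ e) → t ≠ c → t ≠ d → SPGoodC E C x s t)
    (hac : IsKNet Qac x c) (had : IsKNet Qad x d) (hbc : IsKNet Qbc y c) (hbd : IsKNet Qbd y d) (hcd : IsKNet Qcd c d)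
    (hsep : BridgeSep Qac Qad Qbc Qbd Qcd x y c d) (h₂ : IsKNet E₂ x y) (hd : Disjoint (Qac ∪ Qad ∪ Qbc ∪ Qbd ∪ Qcd) E₂) (hN : Qac ∪ Qad ∪ Qbc ∪ Qbd ∪ Qcd ∪ E₂ ⊆ N₀)
    (hV : ∀ z : V, (∃ e ∈ Qac ∪ Qad ∪ Qbc ∪ Qbd ∪ Qcd, z ∈ e) → (∃ e ∈ E₂, z ∈ e) → z = x ∨ z = y)
    (hE : E ⊆ Qac ∪ Qad ∪ Qbc ∪ Qbd ∪ Qcd ∪ E₂) (hC : C ⊆ Qac ∪ Qad ∪ Qbc ∪ Qbd ∪ Qcd ∪ E₂) (hcard : (Qac ∪ Qad ∪ Qbc ∪ Qbd ∪ Qcd).card ≤ n + 1)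
    (hs : ∃ e ∈ Qac ∪ Qad ∪ Qbc ∪ Qbd ∪ Qcd, s ∈ e) (ht : ∃ e ∈ Qac ∪ Qad ∪ Qbc ∪ Qbd ∪ Qcd, t ∈ e)
    (hsx : s ≠ x) (hsy : s ≠ y) (htx : t ≠ x) (hty : t ≠ y) (hst : s ≠ t) : SPGoodC E C x s t := by
  have eSw : Qac ∪ Qad ∪ Qbc ∪ Qbd ∪ Qcd = Qad ∪ Qac ∪ Qbd ∪ Qbc ∪ Qcd := by ac_rfl
  -- a corner marked: THEOREM 𝒯₂(𝒦) at the view through that corner and the pole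
  by_cases hsc : s = c
  · subst hsc
    obtain ⟨e, he, hte⟩ := ht
    exact pbK_bridge_corner_any hac had hbc hbd hcd hsep h₂ hd hV hE hC ⟨e, Finset.mem_union_left _ he, hte⟩ htx (Ne.symm hst)
  by_cases hsd : s = d
  · subst hsd
    rw [eSw] at hd hN hV hE hC ht
    obtain ⟨e, he, hte⟩ := ht
    exact pbK_bridge_corner_any had hac hbd hbc hcd.symm hsep.swap_cd h₂ hd hV hE hC ⟨e, Finset.mem_union_left _ he, hte⟩ htx
      (Ne.symm hst)
  by_cases htc : t = c
  · subst htc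
    obtain ⟨e, he, hse⟩ := hs
    exact (pbK_bridge_corner_any hac had hbc hbd hcd hsep h₂ hd hV hE hC ⟨e, Finset.mem_union_left _ he, hse⟩ hsx hsc).swap23
  by_cases htd : t = d
  · subst htd
    rw [eSw] at hd hN hV hE hC hs
    obtain ⟨e, he, hse⟩ := hs
    exact (pbK_bridge_corner_any had hac hbd hbc hcd.symm hsep.swap_cd h₂ hd hV hE hC ⟨e, Finset.mem_union_left _ he, hse⟩ hsx
      hsd).swap23
  -- both marks interior to slots
  obtain ⟨e, he, hse⟩ := hs
  obtain ⟨f, hf, htf⟩ := ht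
  simp only [Finset.mem_union] at he hf
  -- membership of the other mark in the big side of the view at `ac` / at `ad`
  have inB : ∀ {z : V} {Q : Finset (Sym2 V)}, (∃ g ∈ Q, z ∈ g) → (Q = Qad ∨ Q = Qbc ∨ Q = Qcd ∨ Q = Qbd) →
      ∃ g ∈ E₂ ∪ Qad ∪ Qbc ∪ Qcd ∪ Qbd, z ∈ g := by
    rintro z Q ⟨g, hg, hzg⟩ hQ
    refine ⟨g, ?_, hzg⟩
    simp only [Finset.mem_union]
    rcases hQ with rfl | rfl | rfl | rfl
    · exact Or.inl (Or.inl (Or.inl (Or.inr hg)))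
    · exact Or.inl (Or.inl (Or.inr hg))
    · exact Or.inl (Or.inr hg)
    · exact Or.inr hg
  have inB' : ∀ {z : V} {Q : Finset (Sym2 V)}, (∃ g ∈ Q, z ∈ g) → (Q = Qac ∨ Q = Qbd ∨ Q = Qcd ∨ Q = Qbc) →
      ∃ g ∈ E₂ ∪ Qac ∪ Qbd ∪ Qcd ∪ Qbc, z ∈ g := by
    rintro z Q ⟨g, hg, hzg⟩ hQ
    refine ⟨g, ?_, hzg⟩
    simp only [Finset.mem_union]
    rcases hQ with rfl | rfl | rfl | rfl
    · exact Or.inl (Or.inl (Or.inl (Or.inr hg)))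
    · exact Or.inl (Or.inl (Or.inr hg))
    · exact Or.inl (Or.inr hg)
    · exact Or.inr hg
  rcases he with (((he | he) | he) | he) | he
  · -- s ∈ Qac
    rcases hf with (((hf | hf) | hf) | hf) | hf
    · exact pbK_bridge_slot_ac ih hac had hbc hbd hcd hsep h₂ hd hN hV hE hC hcard ⟨e, he, hse⟩ ⟨f, hf, htf⟩ hsx hsc htx htc hst
    · exact pbK_bridge_x_corner hac had hbc hbd hcd hsep h₂ hd hV hE hC ⟨e, he, hse⟩ hsx hsc (inB ⟨f, hf, htf⟩ (Or.inl rfl)) htx htc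
    · exact pbK_bridge_x_corner hac had hbc hbd hcd hsep h₂ hd hV hE hC ⟨e, he, hse⟩ hsx hsc
        (inB ⟨f, hf, htf⟩ (Or.inr (Or.inl rfl))) htx htc
    · exact pbK_bridge_x_corner hac had hbc hbd hcd hsep h₂ hd hV hE hC ⟨e, he, hse⟩ hsx hsc
        (inB ⟨f, hf, htf⟩ (Or.inr (Or.inr (Or.inr rfl)))) htx htc
    · exact pbK_bridge_x_corner hac had hbc hbd hcd hsep h₂ hd hV hE hC ⟨e, he, hse⟩ hsx hsc
        (inB ⟨f, hf, htf⟩ (Or.inr (Or.inr (Or.inl rfl)))) htx htc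
  · -- s ∈ Qad: swap `c ↔ d`
    rw [eSw] at hd hN hV hE hC hcard
    rcases hf with (((hf | hf) | hf) | hf) | hf
    · exact pbK_bridge_x_corner had hac hbd hbc hcd.symm hsep.swap_cd h₂ hd hV hE hC ⟨e, he, hse⟩ hsx hsd
        (inB' ⟨f, hf, htf⟩ (Or.inl rfl)) htx htd
    · exact pbK_bridge_slot_ac ih had hac hbd hbc hcd.symm hsep.swap_cd h₂ hd hN hV hE hC hcard ⟨e, he, hse⟩ ⟨f, hf, htf⟩ hsx hsd htx
        htd hst
    · exact pbK_bridge_x_corner had hac hbd hbc hcd.symm hsep.swap_cd h₂ hd hV hE hC ⟨e, he, hse⟩ hsx hsd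
        (inB' ⟨f, hf, htf⟩ (Or.inr (Or.inr (Or.inr rfl)))) htx htd
    · exact pbK_bridge_x_corner had hac hbd hbc hcd.symm hsep.swap_cd h₂ hd hV hE hC ⟨e, he, hse⟩ hsx hsd
        (inB' ⟨f, hf, htf⟩ (Or.inr (Or.inl rfl))) htx htd
    · exact pbK_bridge_x_corner had hac hbd hbc hcd.symm hsep.swap_cd h₂ hd hV hE hC ⟨e, he, hse⟩ hsx hsd
        (inB' ⟨f, hf, htf⟩ (Or.inr (Or.inr (Or.inl rfl)))) htx htd
  · -- s ∈ Qbc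
    rcases hf with (((hf | hf) | hf) | hf) | hf
    · exact (pbK_bridge_x_corner hac had hbc hbd hcd hsep h₂ hd hV hE hC ⟨f, hf, htf⟩ htx htc
        (inB ⟨e, he, hse⟩ (Or.inr (Or.inl rfl))) hsx hsc).swap23
    · rw [eSw] at hd hN hV hE hC hcard
      exact (pbK_bridge_x_corner had hac hbd hbc hcd.symm hsep.swap_cd h₂ hd hV hE hC ⟨f, hf, htf⟩ htx htd
        (inB' ⟨e, he, hse⟩ (Or.inr (Or.inr (Or.inr rfl)))) hsx hsd).swap23
    · exact pbK_bridge_slot_bc hTypeI hac had hbc hbd hcd hsep h₂ hd hN hV hE hC ⟨e, he, hse⟩ ⟨f, hf, htf⟩ hsy hsc hty htc hst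
    · exact hVeeY hac had hbc hbd hcd hsep h₂ hd hN hV hE hC ⟨e, he, hse⟩ hsy hsc ⟨f, hf, htf⟩ hty htd
    · exact hVeeC hac had hbc hbd hcd hsep h₂ hd hN hV hE hC ⟨e, he, hse⟩ hsy hsc ⟨f, hf, htf⟩ htc htd
  · -- s ∈ Qbd: swap `c ↔ d`
    rcases hf with (((hf | hf) | hf) | hf) | hf
    · exact (pbK_bridge_x_corner hac had hbc hbd hcd hsep h₂ hd hV hE hC ⟨f, hf, htf⟩ htx htc
        (inB ⟨e, he, hse⟩ (Or.inr (Or.inr (Or.inr rfl)))) hsx hsc).swap23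
    · rw [eSw] at hd hN hV hE hC hcard
      exact (pbK_bridge_x_corner had hac hbd hbc hcd.symm hsep.swap_cd h₂ hd hV hE hC ⟨f, hf, htf⟩ htx htd
        (inB' ⟨e, he, hse⟩ (Or.inr (Or.inl rfl))) hsx hsd).swap23
    · exact (hVeeY hac had hbc hbd hcd hsep h₂ hd hN hV hE hC ⟨f, hf, htf⟩ hty htc ⟨e, he, hse⟩ hsy hsd).swap23
    · rw [eSw] at hd hN hV hE hC hcard
      exact pbK_bridge_slot_bc hTypeI had hac hbd hbc hcd.symm hsep.swap_cd h₂ hd hN hV hE hC ⟨e, he, hse⟩ ⟨f, hf, htf⟩ hsy hsd hty htd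
        hst
    · rw [eSw] at hd hN hV hE hC hcard
      exact hVeeC had hac hbd hbc hcd.symm hsep.swap_cd h₂ hd hN hV hE hC ⟨e, he, hse⟩ hsy hsd ⟨f, hf, htf⟩ htd htc
  · -- s ∈ Qcd
    rcases hf with (((hf | hf) | hf) | hf) | hf
    · exact (pbK_bridge_x_corner hac had hbc hbd hcd hsep h₂ hd hV hE hC ⟨f, hf, htf⟩ htx htc
        (inB ⟨e, he, hse⟩ (Or.inr (Or.inr (Or.inl rfl)))) hsx hsc).swap23
    · rw [eSw] at hd hN hV hE hC hcard
      exact (pbK_bridge_x_corner had hac hbd hbc hcd.symm hsep.swap_cd h₂ hd hV hE hC ⟨f, hf, htf⟩ htx htd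
        (inB' ⟨e, he, hse⟩ (Or.inr (Or.inr (Or.inl rfl)))) hsx hsd).swap23
    · exact (hVeeC hac had hbc hbd hcd hsep h₂ hd hN hV hE hC ⟨f, hf, htf⟩ hty htc ⟨e, he, hse⟩ hsc hsd).swap23
    · rw [eSw] at hd hN hV hE hC hcard
      exact (hVeeC had hac hbd hbc hcd.symm hsep.swap_cd h₂ hd hN hV hE hC ⟨f, hf, htf⟩ hty htd ⟨e, he, hse⟩ hsd hsc).swap23
    · exact pbK_bridge_slot_cd hTypeI hac had hbc hbd hcd hsep h₂ hd hN hV hE hC ⟨e, he, hse⟩ ⟨f, hf, htf⟩ hsc hsd htc htd hst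

end PbBridge

end FK

end Summit.CriticalPhenomena.PercolationContinuityZ3.Theorems
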